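import Literature.MathematicalPhysics.QuantumFieldTheory.Balaban1983to89.B9Eq3120DeltaPiPrimeFormDiagonalClosed
import Literature.MathematicalPhysics.QuantumFieldTheory.Balaban1983to89.B9Eq3130HessianSlotPerturbationTwoWindows
import Literature.MathematicalPhysics.QuantumFieldTheory.Balaban1983to89.B9Eq3119DeltaPiTower

/-!
# `Balaban1983to89.B9Eq3120DeltaPiPrimeFormTwoWindows` — T. Bałaban, *Propagators for lattice gauge theories in a background field*, Commun. Math. Phys. **99**
# (1985) 389–434 [Balaban1985BackgroundPropagators] (3.119)–(3.120) p. 419, (3.122) p. 420, (3.130) p. 421, Thm 3.11 p. 416 and the small-field class (3.35) p. 396,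
# ON PRINT's DIAGONAL `ηL^{n+1} = 1`: **«Δ′_π IS A SMALL PERTURBATION OF Δ_a» AND THE PASSAGE `G₀ ↦ G̃` IN THE ENERGY CURRENCY ON PRINT's CLASS (3.35) — NO
# PROFILE BINDER**: §1 the θ-letter `‖⟨u, (π_k†Δ^η(U)π_k − Δ^η(U))v⟩‖ ≤ θ·α·N₁(u)N₁(v)` of the row OWNER t4-ne9-p1 g87's port (ne9-leaf-02 g67's closing
# corollary `B9Eq3120DeltaPiPrimeFormDiagonalClosed` of the OWNER's assembly `B9Eq3120DeltaPiPrimeFormDiagonal` with leaf-02's λ-letters) with the level-profile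
# binders STRUCK by this lineage's α-linear two-window feed; §2 THE JUNCTION with this lineage's `B9Eq3130HessianSlotPerturbationTwoWindows`: on print's class,
# print's operator `Δ̃_{a,k}(U) = π_k†Δ^ηπ_k + D_UR_kD*_U + Q_k*aQ_k` (3.122) is `γ₁∕2`-strongly coercive and positive definite, and its Green's function differs
# from `G_k(U) = G₀` by `O(α)` in the flat energy norm — (3.130) to first order, `∃ α₀ γ₁ C` before every binder

statement-level skeleton of published theorems with citation tags; proofs where landed; nothing here is a claim about the Yang–Mills mass gap

CITATION HEADER (lean-in-tree rule).  Audit cell `pub-balaban`, sub-cell `t4`, BINDER row NE9; filed by NE9 crux-team (2) leaf prover 03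
(`b2b-balaban-t4-ne9-formalise-leaf-03`, gen 67), INTENT I-ne9leaf03-g67-B (journal [NE9LEAF03-G67-ONLINE] ∕ [NE9LEAF03-G67-STAGED-A]; re-scoped on ne9-leaf-02
g67's word [NE9LEAF02-G67-INTENT4] «-B as you re-scoped it is LIVE on it, yours»).  Host files: the OWNER's plan v7 «the Δ_π port» (`g87/DELTA-PI-PROGRAMME.md`)
steps (ii) (leaf-02's `B9Eq34CurlGaugeModeWindow` + `B9Eq325GaugeModeLetterDiagonal`, the OWNER's `B9Eq3120DeltaPiPrimeFormDiagonal`, leaf-02's `…Closed`) and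
(iii)∕(iv-G) (the OWNER's `B9Eq3130HessianSlotPerturbationDiagonal`, this lineage's `…TwoWindows`).  Sources READ in the held text
`paper:balaban1985-cmp99-background-propagators` (journal page = PDF page + 388) pp. 396, 416, 419–421.  Objects BY NAME: `hessOp`, `GpOfUk`, `RofUk`, `QkW`,
`laplacePrimeAk`, `laplaceALatticeK`, `greenK`, `covDerivL2K`, `covDivL2K`, `covCurlL2K`; nothing re-declared, 0 `def`.

THE PRINT (verbatim).  p. 419: *«The quadratic form Δ′π is a small perturbation of Δ. Later we will write bounds for this form»*; p. 420: *«It differs from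
the operator investigated in previous sections by the additional term Δ′_π, but we will prove that this term is a small perturbation of Δ_a, and that the
operator G used in the above formula has all the properties formulated in Theorems 3.3, 3.10, 3.11»*; p. 421: *«G = G₀(I − Δ′_πG₀)⁻¹ (3.130)»*; p. 396: the
small-field class (3.35) — bonds `αη`-close, plaquettes `αη²`-close.

WHY THIS FILE (cell context).  The port's θ-letter (step (ii)) is closed by leaf-02 on the OWNER's DIAGONAL class, which carries the level profile
`‖Ū^j(b) − 1‖ ≤ ε_j ≤ αr^j`, `Ū^j(b) ∈ U1`, `U(b) ∈ U1` as HYPOTHESES; steps (iii)∕(iv-G) are the OWNER's abstract-slot (3.130), two-windowed by this lineage.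
On print's class (3.35) the profile is a CONSEQUENCE ([Balaban1985Averaging] Prop. 2 iterated, packaged α-linearly as `twoWindows_linear_feed`, class parameter
`Kα`, `K = 1 + 512(d+1)(d+4)`).  §1 strikes the profile from the θ-letter (`θ ↦ Kθ`); §2 plugs §1 into the two-window (3.130) at `θ := θ·α ≤ γ₁∕2`, i.e.
`α ≤ γ₁∕(2θ)`: the passage `G₀ ↦ G̃` of p. 421 on print's own class, with NO operator letter, NO profile, NO θ — only the two windows, E162's data (the
arguments of `Q_k`), `hRS`, `ρ_w`, the positivity `hpos′` of the site operator defining `G′_k`, and the Green's-function witnesses.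

WHAT IS PROVED (sorry-free; proof lane — 0 `def`; [folklore] binder plumbing + one threshold).
* §1 **`exists_form_defect_pi_twoWindows`** — `∃ α₀ θ > 0` BEFORE `∀ n η (ηL^{n+1} = 1) c₀ c₁ (c₀(L^{n+1})^d = c₁) (|η|^d∕c₀ ≤ ρ_w) m U hRS S (AvgClosed)
  (U(b) ∈ S) α (0 ≤ α ≤ α₀) (‖U(b) − 1‖ ≤ αη) (‖U(∂p) − 1‖ ≤ αη²) hpos′ u v`:
  `‖⟨u, (π_k† ∘ Δ^η(U) ∘ π_k)v⟩ − ⟨u, Δ^η(U)v⟩‖ ≤ θ·α·N₁(u)·N₁(v)`, `π_k = 1 − D_U G′_k R_k D*_U` written out (`= B9Eq3119DeltaPiTower.piOfUk … (GpOfUk …)`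
  definitionally) — leaf-02's `exists_form_defect_pi_diagonal_closed` at `r = 1∕L`, fed at `β = Kα` (`θ := Kθ^{host}`).
* §2 **`exists_laplaceAkPi_perturbation_twoWindows`** — `∃ α₀ γ₁ C > 0` BEFORE the same binders + E162's data `αU hα1 hU1 hreg` (arguments of `Q_k`) + `hpos′`:
  (a) `(γ₁∕2)·N₁(x)² ≤ re⟨x, Δ̃_{a,k}(U)x⟩` for `Δ̃_{a,k}(U) := laplaceALatticeK η⁻¹ R(U) R(U⁻¹) (π_k†Δ^η(U)π_k) (R_k(U)) (Q_k(U)) a` (`= B9Eq3119DeltaPiTower.laplaceAkPi …`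
  definitionally); (b) `0 < re⟨x, Δ̃_{a,k}(U)x⟩` for `x ≠ 0` — the positivity `hpos` of print's operator INHABITED on the class; (c) for ANY witnesses `hpos₁`
  (of `Δ̃_{a,k}(U)`) and `hposU` (of the chain's `Δ_{a,k}(U) = laplaceAk`) and every `y`: `‖G̃_ky − G_ky‖, ‖curl₁(…)‖, ‖div₁(…)‖ ≤ C·α·‖y‖` (`C = (2∕γ₁²)·θ`).
* §3 **`exists_laplaceAkPi_perturbation_twoWindows'`** — §2 VERBATIM with print's operator NAMED: `B9Eq3119DeltaPiTower.laplaceAkPi L m n φ τ η U a′ hpos′ hL αU hα1 hU1 hreg a`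
  (the row OWNER's INTENT-4, definition lane ✓) in the three slots — by `rfl`-unfolding of `laplaceAkPi`∕`piOfUk`; this is the form whose (b) is LITERALLY the
  `hpos` binder of `laplaceAkPi`'s consumers (`frakGLatticeK`∕`H1LatticeK`∕the `cur U` chart at print's operator).
HONEST SCOPE.  [folklore]; the two WINDOWS, E162's data, `hRS`, `ρ_w`, `hpos′` and the witnesses stay HYPOTHESES (`hpos′` is inhabited on the class by the site
coercivity — `B9Eq324DeltaPrimeATower.laplacePrimeAk_pos_of_coercive′` with `B9Thm311SitePrimeFormCoerciveTowerCanonical` — not done here); the fine-bond window is NOT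
derived from plaquettes (torus holonomies; per cube = the IMS road); energy currency on the diagonal only, no Neumann series, no operator norm of `Δ′_π`, no decay,
NOT the (N)-reading, NOT print's (3.131) `J`-form of `Δ′_π` (the `L²×L²` bound Thm 3.12 needs).  «NE9 ⇐ the named binders»; NE9 NOT PRINTED ∕ NOT PROVED; NOT summit
progress (cell pub-balaban: row NE9 WALLED ON A MODEL (O-NE9-1; #5 UNRULED); spine PROVED 0/9; rung (B)+1 finite T⁴ — NOT infinite volume, NOT mass gap, NOT
BetaPertH, NOT Clay; HONEST DEPENDENCY: continuum YM on T⁴ ⇐ BetaPertH ∧ nine spine estimates (0/9 proved); BetaPertH ⇐ (D1) ∧ (D4) ∧ CAP+tail; G-an2-4 gates asym,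
D1 and NE2/3/4).  NEW file; nothing modified.  Net new unproved facts: 0.
-/

noncomputable section

open scoped InnerProductSpace ComplexConjugate BigOperators

namespace Literature.MathematicalPhysics.QuantumFieldTheory.Balaban1983to89.B9Eq3120DeltaPiPrimeFormTwoWindows

open B4Sect5Torus (TSite)
open B9SectCLatticeCarrier (Bond)
open B11Eq103H1Complex (SiteL2K BondL2K covDerivL2K covDivL2K laplaceALatticeK greenK)
open B9Eq310HessianOperator (adTransportW hessOp covCurlL2K)
open B9Eq310DeltaPrime (plaqHolU)
open B9Eq315QTorus (perCfg cornerSite)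
open B9Eq315QTower (towerP UlevOf)
open B9Eq326OperatorTower (laplaceAk QkW RofUk)
open B9Eq324DeltaPrimeATower (laplacePrimeAk GpOfUk)
open B9Eq3119DeltaPiTower (piOfUk laplaceAkPi)
open B7Prop1Explicit (U1 Wcx boxVec)
open B7Prop2Explicit (AvgClosed)
open B9Eq3120DeltaPiPrimeFormDiagonalClosed (exists_form_defect_pi_diagonal_closed)
open B9Eq3130HessianSlotPerturbationTwoWindows (exists_hessian_slot_perturbation_twoWindows)
open B7Eq43AveragedSmallnessLinearFeed (twoWindows_linear_feed)

variable {d : ℕ} (L : ℕ) [NeZero L] (hL : 1 ≤ L) (hL2 : 2 ≤ L)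
  {𝔸 : Type*} [NormedRing 𝔸] [NormedAlgebra ℂ 𝔸] [CompleteSpace 𝔸] [NormOneClass 𝔸] [StarRing 𝔸] [NormedStarGroup 𝔸] [StarModule ℂ 𝔸]
  {W : Type*} [NormedAddCommGroup W] [InnerProductSpace ℂ W] [FiniteDimensional ℂ W] (φ : W ≃ₗ[ℂ] 𝔸)
  {Mφ Mφ' : ℝ} (hMφ : 0 ≤ Mφ) (hMφ' : 0 ≤ Mφ') (hφ : ∀ w, ‖φ w‖ ≤ Mφ * ‖w‖) (hφ' : ∀ X, ‖φ.symm X‖ ≤ Mφ' * ‖X‖)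
  {a : ℝ} (ha : 0 < a) {a' : ℝ} (ha' : 0 < a') (τ : 𝔸 →ₗ[ℂ] ℂ) {Cτ : ℝ} (hτ : ∀ X, ‖τ X‖ ≤ Cτ * ‖X‖) (hCτ : 0 ≤ Cτ) {ρw : ℝ} (hρw : 0 ≤ ρw)

/-! ## §1 The θ-letter of the port on print's class (3.35): no profile binder -/

include hL2 hMφ hMφ' hφ hφ' ha' hτ hCτ hρw in
/-- **«Δ′_π IS A SMALL PERTURBATION OF Δ» ON PRINT's CLASS (3.35) — NO PROFILE BINDER**: `∃ α₀ θ > 0` before every binder; for every `n`, `η` (`ηL^{n+1} = 1`),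
weights, `m`, background `U` valued in an averaging-closed `S`, mutually adjoint transporters, `0 ≤ α ≤ α₀`, in the two windows `‖U(b) − 1‖ ≤ αη`,
`‖U(∂p) − 1‖ ≤ αη²`, and ANY positivity witness `hpos′` of the site operator `Δ′_{a′,k}(U)`:
`‖⟨u, (π_k†Δ^η(U)π_k)v⟩ − ⟨u, Δ^η(U)v⟩‖ ≤ θ·α·N₁(u)·N₁(v)` with `π_k = 1 − D_UG′_kR_kD*_U` — ne9-leaf-02's `exists_form_defect_pi_diagonal_closed` at
`r = 1∕L`, fed at `β = Kα` by `twoWindows_linear_feed` (`θ := Kθ^{host}`). [folklore]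
[cite: Balaban1985BackgroundPropagators, (3.119)–(3.120) p.419, (3.122) p.420, (3.35)–(3.37) p.396, Thm 3.11 p.416; Balaban1985Averaging, Prop. 2 (52)–(54) p.26] -/
theorem exists_form_defect_pi_twoWindows :
    ∃ α₀ θ : ℝ, 0 < α₀ ∧ 0 < θ ∧ ∀ (n : ℕ) (η : ℝ), η * (L : ℝ) ^ (n + 1) = 1 →
      ∀ (c₀ c₁ : ℝ) [Fact (0 < c₀)] [Fact (0 < c₁)], c₀ * ((L : ℝ) ^ (n + 1)) ^ d = c₁ → |η| ^ d / c₀ ≤ ρw →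
      ∀ (m : Fin d → ℕ) [∀ i, NeZero (m i)] (U : Bond d (towerP L m (n + 1)) → 𝔸ˣ),
        (∀ (b : Bond d (towerP L m (n + 1))) (v u : W), ⟪adTransportW φ U b v, u⟫_ℂ = ⟪v, adTransportW φ (fun b => (U b)⁻¹) b u⟫_ℂ) →
      ∀ {S : Subgroup 𝔸ˣ}, AvgClosed d L S → (∀ b, U b ∈ S) →
      ∀ (α : ℝ), 0 ≤ α → α ≤ α₀ → (∀ b, ‖(U b : 𝔸) - 1‖ ≤ α * η) →
        (∀ p : B9SectCLatticeCarrier.Plaq d (towerP L m (n + 1)), ‖(plaqHolU U p : 𝔸) - 1‖ ≤ α * η ^ 2) →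
      ∀ (hpos' : ∀ x : SiteL2K ℂ d (towerP L m (n + 1)) c₀ W, x ≠ 0 →
          0 < RCLike.re ⟪x, laplacePrimeAk L m n φ η U a' (c₁ := c₁) x⟫_ℂ)
        (u v : BondL2K ℂ d (towerP L m (n + 1)) c₀ W),
    ‖⟪u, (LinearMap.adjoint ((LinearMap.id : BondL2K ℂ d (towerP L m (n + 1)) c₀ W →ₗ[ℂ] BondL2K ℂ d (towerP L m (n + 1)) c₀ W) -
            covDerivL2K ℂ c₀ ((η : ℂ))⁻¹ (adTransportW φ U) ∘ₗ GpOfUk L m n φ η U a' hpos' ∘ₗ RofUk L m n φ η U ∘ₗ covDivL2K ℂ c₀ ((η : ℂ))⁻¹ (adTransportW φ fun b => (U b)⁻¹)) ∘ₗ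
          hessOp φ η U τ ∘ₗ
          ((LinearMap.id : BondL2K ℂ d (towerP L m (n + 1)) c₀ W →ₗ[ℂ] BondL2K ℂ d (towerP L m (n + 1)) c₀ W) -
            covDerivL2K ℂ c₀ ((η : ℂ))⁻¹ (adTransportW φ U) ∘ₗ GpOfUk L m n φ η U a' hpos' ∘ₗ RofUk L m n φ η U ∘ₗ covDivL2K ℂ c₀ ((η : ℂ))⁻¹ (adTransportW φ fun b => (U b)⁻¹))) v⟫_ℂ -
        ⟪u, hessOp φ η U τ v⟫_ℂ‖ ≤
      θ * α *
        Real.sqrt (‖covCurlL2K ℂ c₀ ((η : ℂ))⁻¹ (adTransportW φ (fun _ : Bond d (towerP L m (n + 1)) => (1 : 𝔸ˣ))) u‖ ^ 2 +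
          ‖covDivL2K ℂ c₀ ((η : ℂ))⁻¹ (adTransportW φ fun _ : Bond d (towerP L m (n + 1)) => (1 : 𝔸ˣ)⁻¹) u‖ ^ 2 + ‖u‖ ^ 2) *
        Real.sqrt (‖covCurlL2K ℂ c₀ ((η : ℂ))⁻¹ (adTransportW φ (fun _ : Bond d (towerP L m (n + 1)) => (1 : 𝔸ˣ))) v‖ ^ 2 +
          ‖covDivL2K ℂ c₀ ((η : ℂ))⁻¹ (adTransportW φ fun _ : Bond d (towerP L m (n + 1)) => (1 : 𝔸ˣ)⁻¹) v‖ ^ 2 + ‖v‖ ^ 2) := by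
  have hL0 : (0 : ℝ) < L := by exact_mod_cast lt_of_lt_of_le (by norm_num) hL2
  have hr0 : (0 : ℝ) ≤ 1 / (L : ℝ) := by positivity
  have hr1 : 1 / (L : ℝ) < 1 := by rw [div_lt_one hL0]; exact_mod_cast lt_of_lt_of_le (by norm_num) hL2
  -- leaf-02's closing corollary at `r = 1∕L`
  obtain ⟨α₁, θ, hα₁, hθ, H⟩ := exists_form_defect_pi_diagonal_closed (d := d) L φ hMφ hMφ' hφ hφ' ha' hr0 hr1 τ hτ hCτ hρw
  -- the α-linear feed below its threshold
  obtain ⟨T, hT, F⟩ := twoWindows_linear_feed L hL2 (d := d) (𝔸 := 𝔸) hα₁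
  have hK0 : (0 : ℝ) < 1 + 512 * (d + 1) * (d + 4) := by positivity
  refine ⟨T, θ * (1 + 512 * (d + 1) * (d + 4)), hT, by positivity, ?_⟩
  intro n η hηL c₀ c₁ _ _ hw hρ m _ U hRS S hS hU α hα0 hαle hUη hpl hpos' u v
  obtain ⟨hβ0, hβ1, hUb, hUη', hpl', hU1', εU, hεU, hUε, hεg⟩ := F m n hS hU hηL hα0 hαle hUη hpl
  have h := H n η hηL c₀ c₁ hw hρ m U hRS _ hβ0 hβ1 hUb hUη' hpl' εU hεU hεg hUε hU1' hpos' u v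
  refine h.trans_eq ?_
  ring

/-! ## §2 The junction: print's operator (3.122) on print's class — positive definite, `γ₁∕2`-coercive, `G̃_k − G_k = O(α)` in the energy norm -/

include hL2 hMφ hMφ' hφ hφ' ha ha' hτ hCτ hρw in
/-- **THE PASSAGE `G₀ ↦ G̃` (3.130) ON PRINT's CLASS (3.35), IN THE ENERGY CURRENCY — NO OPERATOR LETTER, NO PROFILE, NO θ**: `∃ α₀ γ₁ C > 0` before every binder;
for every `n`, `η` (`ηL^{n+1} = 1`), weights, `m`, background `U` of E162's data valued in an averaging-closed `S`, `0 ≤ α ≤ α₀`, mutually adjoint transporters,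
in the two windows, and ANY positivity witness `hpos′` of `Δ′_{a′,k}(U)` (defining `G′_k`): (a) `(γ₁∕2)·N₁(x)² ≤ re⟨x, Δ̃_{a,k}(U)x⟩` for print's operator
`Δ̃_{a,k}(U) = π_k†Δ^η(U)π_k + D_UR_k(U)D*_U + Q_k(U)*aQ_k(U)` ((3.122), `= B9Eq3119DeltaPiTower.laplaceAkPi …` definitionally); (b) `Δ̃_{a,k}(U)` is positive definite
— its `hpos` INHABITED; (c) for ANY witnesses `hpos₁`, `hposU` and every `y`: `‖G̃_ky − G_ky‖, ‖curl₁(G̃_ky − G_ky)‖, ‖div₁(G̃_ky − G_ky)‖ ≤ C·α·‖y‖` —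
§1 at `θ := θα ≤ γ₁∕2` inside `B9Eq3130HessianSlotPerturbationTwoWindows.exists_hessian_slot_perturbation_twoWindows`. [folklore]
[cite: Balaban1985BackgroundPropagators, (3.130) p.421, (3.122) p.420, (3.119)–(3.120) p.419, Thm 3.11 p.416, (3.35)–(3.37) p.396; Balaban1985Averaging, Prop. 2 (52)–(54) p.26] -/
theorem exists_laplaceAkPi_perturbation_twoWindows :
    ∃ α₀ γ₁ C : ℝ, 0 < α₀ ∧ 0 < γ₁ ∧ 0 < C ∧ ∀ (n : ℕ) (η : ℝ), η * (L : ℝ) ^ (n + 1) = 1 →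
      ∀ (c₀ c₁ : ℝ) [Fact (0 < c₀)] [Fact (0 < c₁)], c₀ * ((L : ℝ) ^ (n + 1)) ^ d = c₁ → |η| ^ d / c₀ ≤ ρw →
      ∀ (m : Fin d → ℕ) [∀ i, NeZero (m i)] (U : Bond d (towerP L m (n + 1)) → 𝔸ˣ) (αU : ℕ → ℝ) (hα1 : ∀ j, αU j ≤ 1 / 64)
        (hU1 : ∀ (j : ℕ) (x : B7Prop1Explicit.Site d) (κ : Fin d), perCfg (towerP L m (j + 1)) (UlevOf L m (n + 1) U j) x κ ∈ U1 𝔸)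
        (hreg : ∀ (j : ℕ) (y : TSite d (towerP L m j)) (κ : Fin d) (r : Fin d → Fin L),
          ‖((Wcx L (perCfg (towerP L m (j + 1)) (UlevOf L m (n + 1) U j)) (cornerSite L y) κ (boxVec L r) : 𝔸ˣ) : 𝔸) - 1‖ ≤ αU j)
        {S : Subgroup 𝔸ˣ}, AvgClosed d L S → (∀ b, U b ∈ S) →
      ∀ {α : ℝ}, 0 ≤ α → α ≤ α₀ →
        (∀ (b : Bond d (towerP L m (n + 1))) (v u : W), ⟪adTransportW φ U b v, u⟫_ℂ = ⟪v, adTransportW φ (fun b => (U b)⁻¹) b u⟫_ℂ) →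
        (∀ b, ‖(U b : 𝔸) - 1‖ ≤ α * η) →
        (∀ p : B9SectCLatticeCarrier.Plaq d (towerP L m (n + 1)), ‖(plaqHolU U p : 𝔸) - 1‖ ≤ α * η ^ 2) →
        ∀ (hpos' : ∀ x : SiteL2K ℂ d (towerP L m (n + 1)) c₀ W, x ≠ 0 →
          0 < RCLike.re ⟪x, laplacePrimeAk L m n φ η U a' (c₁ := c₁) x⟫_ℂ),
        -- (a) strong coercivity of the perturbed operator
        (∀ x : BondL2K ℂ d (towerP L m (n + 1)) c₀ W,
          γ₁ / 2 * (‖covCurlL2K ℂ c₀ ((η : ℂ))⁻¹ (adTransportW φ (fun _ : Bond d (towerP L m (n + 1)) => (1 : 𝔸ˣ))) x‖ ^ 2 +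
              ‖covDivL2K ℂ c₀ ((η : ℂ))⁻¹ (adTransportW φ fun _ : Bond d (towerP L m (n + 1)) => (1 : 𝔸ˣ)⁻¹) x‖ ^ 2 + ‖x‖ ^ 2) ≤
            RCLike.re ⟪x, laplaceALatticeK ((η : ℂ))⁻¹ (adTransportW φ U) (adTransportW φ fun b => (U b)⁻¹) (LinearMap.adjoint ((LinearMap.id : BondL2K ℂ d (towerP L m (n + 1)) c₀ W →ₗ[ℂ] BondL2K ℂ d (towerP L m (n + 1)) c₀ W) -
                covDerivL2K ℂ c₀ ((η : ℂ))⁻¹ (adTransportW φ U) ∘ₗ GpOfUk L m n φ η U a' hpos' ∘ₗ RofUk L m n φ η U ∘ₗ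
                  covDivL2K ℂ c₀ ((η : ℂ))⁻¹ (adTransportW φ fun b => (U b)⁻¹)) ∘ₗ
              hessOp φ η U τ ∘ₗ ((LinearMap.id : BondL2K ℂ d (towerP L m (n + 1)) c₀ W →ₗ[ℂ] BondL2K ℂ d (towerP L m (n + 1)) c₀ W) -
                covDerivL2K ℂ c₀ ((η : ℂ))⁻¹ (adTransportW φ U) ∘ₗ GpOfUk L m n φ η U a' hpos' ∘ₗ RofUk L m n φ η U ∘ₗ
                  covDivL2K ℂ c₀ ((η : ℂ))⁻¹ (adTransportW φ fun b => (U b)⁻¹))) (RofUk L m n φ η U)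
              (QkW L m n φ U hL αU hα1 hU1 hreg (c₁ := c₁)) a x⟫_ℂ) ∧
        -- (b) positive definiteness
        (∀ x : BondL2K ℂ d (towerP L m (n + 1)) c₀ W, x ≠ 0 →
          0 < RCLike.re ⟪x, laplaceALatticeK ((η : ℂ))⁻¹ (adTransportW φ U) (adTransportW φ fun b => (U b)⁻¹) (LinearMap.adjoint ((LinearMap.id : BondL2K ℂ d (towerP L m (n + 1)) c₀ W →ₗ[ℂ] BondL2K ℂ d (towerP L m (n + 1)) c₀ W) -
                covDerivL2K ℂ c₀ ((η : ℂ))⁻¹ (adTransportW φ U) ∘ₗ GpOfUk L m n φ η U a' hpos' ∘ₗ RofUk L m n φ η U ∘ₗ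
                  covDivL2K ℂ c₀ ((η : ℂ))⁻¹ (adTransportW φ fun b => (U b)⁻¹)) ∘ₗ
              hessOp φ η U τ ∘ₗ ((LinearMap.id : BondL2K ℂ d (towerP L m (n + 1)) c₀ W →ₗ[ℂ] BondL2K ℂ d (towerP L m (n + 1)) c₀ W) -
                covDerivL2K ℂ c₀ ((η : ℂ))⁻¹ (adTransportW φ U) ∘ₗ GpOfUk L m n φ η U a' hpos' ∘ₗ RofUk L m n φ η U ∘ₗ
                  covDivL2K ℂ c₀ ((η : ℂ))⁻¹ (adTransportW φ fun b => (U b)⁻¹))) (RofUk L m n φ η U)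
              (QkW L m n φ U hL αU hα1 hU1 hreg (c₁ := c₁)) a x⟫_ℂ) ∧
        -- (c) the Green's functions differ by `O(θ)` in the flat energy norm
        (∀ (hpos₁ : ∀ x : BondL2K ℂ d (towerP L m (n + 1)) c₀ W, x ≠ 0 →
            0 < RCLike.re ⟪x, laplaceALatticeK ((η : ℂ))⁻¹ (adTransportW φ U) (adTransportW φ fun b => (U b)⁻¹) (LinearMap.adjoint ((LinearMap.id : BondL2K ℂ d (towerP L m (n + 1)) c₀ W →ₗ[ℂ] BondL2K ℂ d (towerP L m (n + 1)) c₀ W) -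
                covDerivL2K ℂ c₀ ((η : ℂ))⁻¹ (adTransportW φ U) ∘ₗ GpOfUk L m n φ η U a' hpos' ∘ₗ RofUk L m n φ η U ∘ₗ
                  covDivL2K ℂ c₀ ((η : ℂ))⁻¹ (adTransportW φ fun b => (U b)⁻¹)) ∘ₗ
              hessOp φ η U τ ∘ₗ ((LinearMap.id : BondL2K ℂ d (towerP L m (n + 1)) c₀ W →ₗ[ℂ] BondL2K ℂ d (towerP L m (n + 1)) c₀ W) -
                covDerivL2K ℂ c₀ ((η : ℂ))⁻¹ (adTransportW φ U) ∘ₗ GpOfUk L m n φ η U a' hpos' ∘ₗ RofUk L m n φ η U ∘ₗ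
                  covDivL2K ℂ c₀ ((η : ℂ))⁻¹ (adTransportW φ fun b => (U b)⁻¹))) (RofUk L m n φ η U)
              (QkW L m n φ U hL αU hα1 hU1 hreg (c₁ := c₁)) a x⟫_ℂ)
          (hposU : ∀ x : BondL2K ℂ d (towerP L m (n + 1)) c₀ W, x ≠ 0 →
            0 < RCLike.re ⟪x, laplaceAk L m n φ η U hL αU hα1 hU1 hreg τ (c₀ := c₀) (c₁ := c₁) a x⟫_ℂ)
          (y : BondL2K ℂ d (towerP L m (n + 1)) c₀ W),
          ‖greenK (laplaceALatticeK ((η : ℂ))⁻¹ (adTransportW φ U) (adTransportW φ fun b => (U b)⁻¹) (LinearMap.adjoint ((LinearMap.id : BondL2K ℂ d (towerP L m (n + 1)) c₀ W →ₗ[ℂ] BondL2K ℂ d (towerP L m (n + 1)) c₀ W) -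
                covDerivL2K ℂ c₀ ((η : ℂ))⁻¹ (adTransportW φ U) ∘ₗ GpOfUk L m n φ η U a' hpos' ∘ₗ RofUk L m n φ η U ∘ₗ
                  covDivL2K ℂ c₀ ((η : ℂ))⁻¹ (adTransportW φ fun b => (U b)⁻¹)) ∘ₗ
              hessOp φ η U τ ∘ₗ ((LinearMap.id : BondL2K ℂ d (towerP L m (n + 1)) c₀ W →ₗ[ℂ] BondL2K ℂ d (towerP L m (n + 1)) c₀ W) -
                covDerivL2K ℂ c₀ ((η : ℂ))⁻¹ (adTransportW φ U) ∘ₗ GpOfUk L m n φ η U a' hpos' ∘ₗ RofUk L m n φ η U ∘ₗ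
                  covDivL2K ℂ c₀ ((η : ℂ))⁻¹ (adTransportW φ fun b => (U b)⁻¹))) (RofUk L m n φ η U)
              (QkW L m n φ U hL αU hα1 hU1 hreg (c₁ := c₁)) a) hpos₁ y -
            greenK (laplaceAk L m n φ η U hL αU hα1 hU1 hreg τ (c₀ := c₀) (c₁ := c₁) a) hposU y‖ ≤ C * α * ‖y‖ ∧
          ‖covCurlL2K ℂ c₀ ((η : ℂ))⁻¹ (adTransportW φ (fun _ : Bond d (towerP L m (n + 1)) => (1 : 𝔸ˣ)))
            (greenK (laplaceALatticeK ((η : ℂ))⁻¹ (adTransportW φ U) (adTransportW φ fun b => (U b)⁻¹) (LinearMap.adjoint ((LinearMap.id : BondL2K ℂ d (towerP L m (n + 1)) c₀ W →ₗ[ℂ] BondL2K ℂ d (towerP L m (n + 1)) c₀ W) -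
                covDerivL2K ℂ c₀ ((η : ℂ))⁻¹ (adTransportW φ U) ∘ₗ GpOfUk L m n φ η U a' hpos' ∘ₗ RofUk L m n φ η U ∘ₗ
                  covDivL2K ℂ c₀ ((η : ℂ))⁻¹ (adTransportW φ fun b => (U b)⁻¹)) ∘ₗ
              hessOp φ η U τ ∘ₗ ((LinearMap.id : BondL2K ℂ d (towerP L m (n + 1)) c₀ W →ₗ[ℂ] BondL2K ℂ d (towerP L m (n + 1)) c₀ W) -
                covDerivL2K ℂ c₀ ((η : ℂ))⁻¹ (adTransportW φ U) ∘ₗ GpOfUk L m n φ η U a' hpos' ∘ₗ RofUk L m n φ η U ∘ₗ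
                  covDivL2K ℂ c₀ ((η : ℂ))⁻¹ (adTransportW φ fun b => (U b)⁻¹))) (RofUk L m n φ η U)
              (QkW L m n φ U hL αU hα1 hU1 hreg (c₁ := c₁)) a) hpos₁ y -
            greenK (laplaceAk L m n φ η U hL αU hα1 hU1 hreg τ (c₀ := c₀) (c₁ := c₁) a) hposU y)‖ ≤ C * α * ‖y‖ ∧
          ‖covDivL2K ℂ c₀ ((η : ℂ))⁻¹ (adTransportW φ fun _ : Bond d (towerP L m (n + 1)) => (1 : 𝔸ˣ)⁻¹)
            (greenK (laplaceALatticeK ((η : ℂ))⁻¹ (adTransportW φ U) (adTransportW φ fun b => (U b)⁻¹) (LinearMap.adjoint ((LinearMap.id : BondL2K ℂ d (towerP L m (n + 1)) c₀ W →ₗ[ℂ] BondL2K ℂ d (towerP L m (n + 1)) c₀ W) -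
                covDerivL2K ℂ c₀ ((η : ℂ))⁻¹ (adTransportW φ U) ∘ₗ GpOfUk L m n φ η U a' hpos' ∘ₗ RofUk L m n φ η U ∘ₗ
                  covDivL2K ℂ c₀ ((η : ℂ))⁻¹ (adTransportW φ fun b => (U b)⁻¹)) ∘ₗ
              hessOp φ η U τ ∘ₗ ((LinearMap.id : BondL2K ℂ d (towerP L m (n + 1)) c₀ W →ₗ[ℂ] BondL2K ℂ d (towerP L m (n + 1)) c₀ W) -
                covDerivL2K ℂ c₀ ((η : ℂ))⁻¹ (adTransportW φ U) ∘ₗ GpOfUk L m n φ η U a' hpos' ∘ₗ RofUk L m n φ η U ∘ₗ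
                  covDivL2K ℂ c₀ ((η : ℂ))⁻¹ (adTransportW φ fun b => (U b)⁻¹))) (RofUk L m n φ η U)
              (QkW L m n φ U hL αU hα1 hU1 hreg (c₁ := c₁)) a) hpos₁ y -
            greenK (laplaceAk L m n φ η U hL αU hα1 hU1 hreg τ (c₀ := c₀) (c₁ := c₁) a) hposU y)‖ ≤ C * α * ‖y‖) := by
  -- the two-window (3.130), abstract in the slot
  obtain ⟨αA, γ₁, hαA, hγ₁, HA⟩ :=
    exists_hessian_slot_perturbation_twoWindows (d := d) L hL hL2 φ hMφ hMφ' hφ hφ' ha τ hτ hCτ hρw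
  -- §1: the θ-letter of print's slot on the class
  obtain ⟨αB, θ, hαB, hθ, HB⟩ := exists_form_defect_pi_twoWindows (d := d) L hL2 φ hMφ hMφ' hφ hφ' ha' τ hτ hCτ hρw
  have hγθ : 0 < γ₁ / (2 * θ) := by positivity
  refine ⟨min αA (min αB (γ₁ / (2 * θ))), γ₁, 2 / γ₁ ^ 2 * θ, lt_min hαA (lt_min hαB hγθ), hγ₁, by positivity, ?_⟩
  intro n η hηL c₀ c₁ _ _ hw hρ m _ U αU hα1 hU1 hreg S hS hU α hα0 hαle hRS hUη hpl hpos'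
  have hαA' : α ≤ αA := hαle.trans (min_le_left _ _)
  have hαB' : α ≤ αB := hαle.trans ((min_le_right _ _).trans (min_le_left _ _))
  have hαθ : α ≤ γ₁ / (2 * θ) := hαle.trans ((min_le_right _ _).trans (min_le_right _ _))
  have hθα0 : 0 ≤ θ * α := by positivity
  have hθαle : θ * α ≤ γ₁ / 2 := by
    rw [le_div_iff₀ (by positivity : (0 : ℝ) < 2 * θ)] at hαθ
    linarith
  have hform := HB n η hηL c₀ c₁ hw hρ m U hRS hS hU α hα0 hαB' hUη hpl hpos'
  obtain ⟨ha', hb', hc'⟩ := HA n η hηL c₀ c₁ hw hρ m U αU hα1 hU1 hreg hS hU hα0 hαA' hRS hUη hpl _ hθα0 hθαle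
    (fun u v => hform u v)
  refine ⟨ha', hb', fun hpos₁ hposU y => ?_⟩
  obtain ⟨h1, h2, h3⟩ := hc' hpos₁ hposU y
  have e : 2 / γ₁ ^ 2 * (θ * α) * ‖y‖ = 2 / γ₁ ^ 2 * θ * α * ‖y‖ := by ring
  exact ⟨h1.trans_eq e, h2.trans_eq e, h3.trans_eq e⟩

/-! ## §3 The same with print's operator NAMED: `B9Eq3119DeltaPiTower.laplaceAkPi` -/

set_option maxRecDepth 8192 in
include hL2 hMφ hMφ' hφ hφ' ha ha' hτ hCτ hρw in
/-- **§2 AT THE NAMED OPERATOR `laplaceAkPi`** (the row OWNER's `B9Eq3119DeltaPiTower`, print's (3.122) `Δ̃_{a,k}(U)` at `G′ := G′_k`): on print's class (3.35),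
`∃ α₀ γ₁ C > 0` first, (a) `(γ₁∕2)·N₁(x)² ≤ re⟨x, laplaceAkPi … x⟩`, (b) `laplaceAkPi …` is positive definite — the `hpos` its consumers display is INHABITED —,
(c) `‖greenK (laplaceAkPi …) hpos₁ y − G_k(U)y‖` and its flat curl∕div rows `≤ C·α·‖y‖` for ANY witnesses; `laplaceAkPi`∕`piOfUk` unfold to §2's written-out
slot by `rfl`. [folklore] [cite: Balaban1985BackgroundPropagators, (3.122) p.420, (3.130) p.421, (3.119)–(3.120) p.419, Thm 3.11 p.416, (3.35)–(3.37) p.396] -/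
theorem exists_laplaceAkPi_perturbation_twoWindows' :
    ∃ α₀ γ₁ C : ℝ, 0 < α₀ ∧ 0 < γ₁ ∧ 0 < C ∧ ∀ (n : ℕ) (η : ℝ), η * (L : ℝ) ^ (n + 1) = 1 →
      ∀ (c₀ c₁ : ℝ) [Fact (0 < c₀)] [Fact (0 < c₁)], c₀ * ((L : ℝ) ^ (n + 1)) ^ d = c₁ → |η| ^ d / c₀ ≤ ρw →
      ∀ (m : Fin d → ℕ) [∀ i, NeZero (m i)] (U : Bond d (towerP L m (n + 1)) → 𝔸ˣ) (αU : ℕ → ℝ) (hα1 : ∀ j, αU j ≤ 1 / 64)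
        (hU1 : ∀ (j : ℕ) (x : B7Prop1Explicit.Site d) (κ : Fin d), perCfg (towerP L m (j + 1)) (UlevOf L m (n + 1) U j) x κ ∈ U1 𝔸)
        (hreg : ∀ (j : ℕ) (y : TSite d (towerP L m j)) (κ : Fin d) (r : Fin d → Fin L),
          ‖((Wcx L (perCfg (towerP L m (j + 1)) (UlevOf L m (n + 1) U j)) (cornerSite L y) κ (boxVec L r) : 𝔸ˣ) : 𝔸) - 1‖ ≤ αU j)
        {S : Subgroup 𝔸ˣ}, AvgClosed d L S → (∀ b, U b ∈ S) →
      ∀ {α : ℝ}, 0 ≤ α → α ≤ α₀ →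
        (∀ (b : Bond d (towerP L m (n + 1))) (v u : W), ⟪adTransportW φ U b v, u⟫_ℂ = ⟪v, adTransportW φ (fun b => (U b)⁻¹) b u⟫_ℂ) →
        (∀ b, ‖(U b : 𝔸) - 1‖ ≤ α * η) →
        (∀ p : B9SectCLatticeCarrier.Plaq d (towerP L m (n + 1)), ‖(plaqHolU U p : 𝔸) - 1‖ ≤ α * η ^ 2) →
        ∀ (hpos' : ∀ x : SiteL2K ℂ d (towerP L m (n + 1)) c₀ W, x ≠ 0 →
          0 < RCLike.re ⟪x, laplacePrimeAk L m n φ η U a' (c₁ := c₁) x⟫_ℂ),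
        (∀ x : BondL2K ℂ d (towerP L m (n + 1)) c₀ W,
          γ₁ / 2 * (‖covCurlL2K ℂ c₀ ((η : ℂ))⁻¹ (adTransportW φ (fun _ : Bond d (towerP L m (n + 1)) => (1 : 𝔸ˣ))) x‖ ^ 2 +
              ‖covDivL2K ℂ c₀ ((η : ℂ))⁻¹ (adTransportW φ fun _ : Bond d (towerP L m (n + 1)) => (1 : 𝔸ˣ)⁻¹) x‖ ^ 2 + ‖x‖ ^ 2) ≤
            RCLike.re ⟪x, laplaceAkPi L m n φ τ η U a' hpos' hL αU hα1 hU1 hreg (c₁ := c₁) a x⟫_ℂ) ∧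
        (∀ x : BondL2K ℂ d (towerP L m (n + 1)) c₀ W, x ≠ 0 →
          0 < RCLike.re ⟪x, laplaceAkPi L m n φ τ η U a' hpos' hL αU hα1 hU1 hreg (c₁ := c₁) a x⟫_ℂ) ∧
        (∀ (hpos₁ : ∀ x : BondL2K ℂ d (towerP L m (n + 1)) c₀ W, x ≠ 0 →
            0 < RCLike.re ⟪x, laplaceAkPi L m n φ τ η U a' hpos' hL αU hα1 hU1 hreg (c₁ := c₁) a x⟫_ℂ)
          (hposU : ∀ x : BondL2K ℂ d (towerP L m (n + 1)) c₀ W, x ≠ 0 →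
            0 < RCLike.re ⟪x, laplaceAk L m n φ η U hL αU hα1 hU1 hreg τ (c₀ := c₀) (c₁ := c₁) a x⟫_ℂ)
          (y : BondL2K ℂ d (towerP L m (n + 1)) c₀ W),
          ‖greenK (laplaceAkPi L m n φ τ η U a' hpos' hL αU hα1 hU1 hreg (c₁ := c₁) a) hpos₁ y -
            greenK (laplaceAk L m n φ η U hL αU hα1 hU1 hreg τ (c₀ := c₀) (c₁ := c₁) a) hposU y‖ ≤ C * α * ‖y‖ ∧
          ‖covCurlL2K ℂ c₀ ((η : ℂ))⁻¹ (adTransportW φ (fun _ : Bond d (towerP L m (n + 1)) => (1 : 𝔸ˣ)))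
            (greenK (laplaceAkPi L m n φ τ η U a' hpos' hL αU hα1 hU1 hreg (c₁ := c₁) a) hpos₁ y -
            greenK (laplaceAk L m n φ η U hL αU hα1 hU1 hreg τ (c₀ := c₀) (c₁ := c₁) a) hposU y)‖ ≤ C * α * ‖y‖ ∧
          ‖covDivL2K ℂ c₀ ((η : ℂ))⁻¹ (adTransportW φ fun _ : Bond d (towerP L m (n + 1)) => (1 : 𝔸ˣ)⁻¹)
            (greenK (laplaceAkPi L m n φ τ η U a' hpos' hL αU hα1 hU1 hreg (c₁ := c₁) a) hpos₁ y -
            greenK (laplaceAk L m n φ η U hL αU hα1 hU1 hreg τ (c₀ := c₀) (c₁ := c₁) a) hposU y)‖ ≤ C * α * ‖y‖) :=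
  exists_laplaceAkPi_perturbation_twoWindows (d := d) L hL hL2 φ hMφ hMφ' hφ hφ' ha ha' τ hτ hCτ hρw

end Literature.MathematicalPhysics.QuantumFieldTheory.Balaban1983to89.B9Eq3120DeltaPiPrimeFormTwoWindows

end
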